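import Summits.HodgeConjecture.CorCM.Census.TypeStabiliserSubgroup

/-!
# Index-two subgroups over the type-stabiliser subgroup: the Klein third, sign characters `G →* ℤ/2`, and `d₂(G/𝒦)` with `2^{d₂} = #{H : [G:H] = 2, 𝒦 ≤ H} + 1`

COR-CM (cell `pub-hodgecm2`), count-neutral kernel combinatorics by the census seat lit-andre-3 (gen 19; lane TYPE-STABILISER-SUBGROUP,
second leaf = b09ʼs (E4)/(E5) input A6-R57), sequel of `Census/TypeStabiliserSubgroup.lean` (`stabGen c = 𝒦(G,c)`).  GENERIC folklore group
theory (any group `G`, any normal `N`; nothing refers to CM types; the sequel instantiates `N := 𝒦(G,c)`).  Four bookkeeping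
definitions with bodies (`kleinThird`, `signChar`, `indexTwoEquiv`, `indexTwoOverEquiv`) + theorems, everything proved;
no `Prop`-valued definition, no `decide` beyond closed identities in `Multiplicative (ZMod 2)`, no certificate, no named fact, no `sorry`.
HONEST FRAMING: `HC_CM` is NOT proved; nothing here is a period or a headline.  (Placed under `Census/` and not `Literature/`: the tree
keeps `Literature/` for CITED statements; these are uncited folklore lemmas serving the closed form
`φ₂(G,c) = β(G,c) + d₂(G/𝒦) − 1 − [|G|/2 even]` of the coinvariant fibre, `Census/HalfParity*` / `Census/Coinvariant*`.)

CONTENT (`G` a group; finiteness only where stated).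
* §1 **The Klein third.**  For two subgroups `H₁, H₂` of index two, `kleinThird H₁ H₂ = {g | g ∈ H₁ ↔ g ∈ H₂}` is a subgroup
  (`mem_kleinThird_iff`) containing `H₁ ⊓ H₂` and different from both (`kleinThird_ne_left/right`); if `H₁ ≠ H₂` it has
  index two (`index_kleinThird`) — the three index-two subgroups containing `H₁ ⊓ H₂` (of index four, Klein quotient).
* §2 **Sign characters.**  `signChar H h : G →* Multiplicative (ZMod 2)` (`h : H.index = 2`) is the character with kernel `H`
  (`ker_signChar`); a character `φ ≠ 1` has `φ.ker.index = 2` (`index_ker_eq_two`) and `signChar φ.ker = φ` (`signChar_ker`);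
  `ker (φ₁·φ₂) = kleinThird (ker φ₁) (ker φ₂)` (`ker_mul_eq_kleinThird`: the Klein relation on the character side);
  whence the bijection `indexTwoEquiv : {H // H.index = 2} ≃ {φ // φ ≠ 1}` and, for finite `G`,
  `card_indexTwo_add_one : #{H : [G:H] = 2} + 1 = #(G →* Multiplicative (ZMod 2))`.
* §3 **Over a normal subgroup.**  `indexTwoOverEquiv N : {H // H.index = 2 ∧ N ≤ H} ≃ {H' : Subgroup (G ⧸ N) // H'.index = 2}`
  (comap along `QuotientGroup.mk' N`), `card_indexTwoOver_add_one`, and `card_indexTwoOver_le_of_mem` (`#{H ⊇ N} ≤ #{H ∋ g}` for `g ∈ N`).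
* §4 **Power of two.**  The sign characters form an elementary abelian `2`-group, so `#(G →* Multiplicative (ZMod 2)) = 2^d`
  (`exists_card_signChar_eq_two_pow`) and `#{H : [G:H] = 2, N ≤ H} + 1 = 2^d` for some `d` (`exists_card_indexTwoOver_add_one_eq_two_pow`)
  — `d = d₂(G/N) = dim_{𝔽₂} Hom(G/N, 𝔽₂)`, the `2`-rank of `(G/N)^{ab}`.
* SEQUEL `Census/TypeStabiliserIndexTwoRank.lean`: the number `indexTwoRank N = d₂(G/N)` (`2 ^ d₂ = #{H} + 1`, `#Hom(G/N, ℤ/2) = 2^{d₂}`,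
  `finrank` packaging) and the instantiation `N := 𝒦(G,c)`.
-/

namespace Summit.HodgeConjecture.CorCM.Census.IndexTwo

open Function

section Generic

variable {G : Type*} [Group G]

/-! ## §1 The Klein third of two index-two subgroups -/

/-- **The Klein third** of two subgroups: the subgroup generated by `{g | g ∈ H₁ ↔ g ∈ H₂}` — which IS that set when both have
index two (`mem_kleinThird_iff`). [folklore] -/
def kleinThird (H₁ H₂ : Subgroup G) : Subgroup G :=
  Subgroup.closure {g : G | g ∈ H₁ ↔ g ∈ H₂}

/-- Membership in the Klein third of two index-two subgroups: `g ∈ K₃ ↔ (g ∈ H₁ ↔ g ∈ H₂)`. [folklore] -/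
theorem mem_kleinThird_iff {H₁ H₂ : Subgroup G} (h₁ : H₁.index = 2) (h₂ : H₂.index = 2) {g : G} :
    g ∈ kleinThird H₁ H₂ ↔ (g ∈ H₁ ↔ g ∈ H₂) := by
  constructor
  · intro hg
    refine Subgroup.closure_induction (fun x hx => hx) ?_ (fun x y _ _ ihx ihy => ?_) (fun x _ ihx => ?_) hg
    · exact ⟨fun _ => H₂.one_mem, fun _ => H₁.one_mem⟩
    · rw [Subgroup.mul_mem_iff_of_index_two h₁, Subgroup.mul_mem_iff_of_index_two h₂]
      change (x ∈ H₁ ↔ x ∈ H₂) at ihx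
      change (y ∈ H₁ ↔ y ∈ H₂) at ihy
      tauto
    · rw [H₁.inv_mem_iff, H₂.inv_mem_iff]
      exact ihx
  · intro hg
    exact Subgroup.subset_closure hg

/-- `H₁ ⊓ H₂ ≤ K₃`. [folklore] -/
theorem inf_le_kleinThird (H₁ H₂ : Subgroup G) : H₁ ⊓ H₂ ≤ kleinThird H₁ H₂ :=
  fun _ hg => Subgroup.subset_closure ⟨fun _ => (Subgroup.mem_inf.mp hg).2, fun _ => (Subgroup.mem_inf.mp hg).1⟩

/-- The Klein third is symmetric. [folklore] -/
theorem kleinThird_comm (H₁ H₂ : Subgroup G) : kleinThird H₁ H₂ = kleinThird H₂ H₁ := by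
  unfold kleinThird
  congr 1
  ext g
  exact Iff.comm

/-- Two subgroups of the same finite index, one inside the other, are equal. [folklore] -/
theorem eq_of_le_of_index_eq {H₁ H₂ : Subgroup G} (hle : H₁ ≤ H₂) (h : H₁.index = H₂.index) (h0 : H₂.index ≠ 0) :
    H₁ = H₂ := by
  have hmul := Subgroup.relIndex_mul_index hle
  rw [h] at hmul
  have h1 : H₁.relIndex H₂ = 1 := by
    have : H₁.relIndex H₂ * H₂.index = 1 * H₂.index := by rw [hmul, one_mul]
    exact Nat.eq_of_mul_eq_mul_right (Nat.pos_of_ne_zero h0) this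
  exact le_antisymm hle (Subgroup.relIndex_eq_one.mp h1)

/-- **The Klein third of two distinct index-two subgroups has index two.** [folklore] -/
theorem index_kleinThird {H₁ H₂ : Subgroup G} (h₁ : H₁.index = 2) (h₂ : H₂.index = 2) (hne : H₁ ≠ H₂) :
    (kleinThird H₁ H₂).index = 2 := by
  -- an element of `H₁ ∖ H₂` exists, otherwise `H₁ ≤ H₂` and the two coincide
  have hex : ∃ a : G, a ∈ H₁ ∧ a ∉ H₂ := by
    by_contra hcon
    push Not at hcon
    exact hne (eq_of_le_of_index_eq (fun x hx => hcon x hx) (by rw [h₁, h₂]) (by rw [h₂]; decide))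
  obtain ⟨a, ha₁, ha₂⟩ := hex
  refine Subgroup.index_eq_two_iff.mpr ⟨a, fun b => ?_⟩
  rw [mem_kleinThird_iff h₁ h₂, mem_kleinThird_iff h₁ h₂, Subgroup.mul_mem_iff_of_index_two h₁,
    Subgroup.mul_mem_iff_of_index_two h₂]
  unfold Xor
  tauto

/-- The Klein third differs from `H₁` (for `H₁ = H₂` it is `⊤`) … [folklore] -/
theorem kleinThird_ne_left {H₁ H₂ : Subgroup G} (h₁ : H₁.index = 2) (h₂ : H₂.index = 2) :
    kleinThird H₁ H₂ ≠ H₁ := by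
  intro heq
  -- some `b ∉ H₁` exists (index two), and some `a ∈ H₁ ∖ H₂`; then `b` and `ba`… simpler: every `g ∉ H₁ ∪ H₂` lies in `K₃`
  obtain ⟨x, hx⟩ := Subgroup.index_eq_two_iff.mp h₂
  -- pick `b ∉ H₂`: from `hx 1`, `Xor' (a' ∈ H₂) (1 ∈ H₂)` gives `x ∉ H₂`
  have hx2 : x ∉ H₂ := by
    have h := hx 1
    rw [one_mul] at h
    unfold Xor at h
    have h1 : (1 : G) ∈ H₂ := H₂.one_mem
    tauto
  by_cases hx1 : x ∈ H₁
  · -- `x ∈ H₁ ∖ H₂` is not in `K₃ = H₁`: contradiction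
    have : x ∈ kleinThird H₁ H₂ := by rw [heq]; exact hx1
    rw [mem_kleinThird_iff h₁ h₂] at this
    exact hx2 (this.mp hx1)
  · -- `x ∉ H₁ ∪ H₂` lies in `K₃ = H₁`: contradiction
    have : x ∈ kleinThird H₁ H₂ := (mem_kleinThird_iff h₁ h₂).mpr ⟨fun h => absurd h hx1, fun h => absurd h hx2⟩
    rw [heq] at this
    exact hx1 this

/-- … and from `H₂`. [folklore] -/
theorem kleinThird_ne_right {H₁ H₂ : Subgroup G} (h₁ : H₁.index = 2) (h₂ : H₂.index = 2) :
    kleinThird H₁ H₂ ≠ H₂ := by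
  rw [kleinThird_comm]
  exact kleinThird_ne_left h₂ h₁

/-! ## §2 Sign characters `G →* ℤ/2` -/

/-- In `Multiplicative (ZMod 2)`: `x ≠ 1 ↔ x = ofAdd 1`. [folklore] -/
theorem ne_one_iff_eq_ofAdd_one (x : Multiplicative (ZMod 2)) : x ≠ 1 ↔ x = Multiplicative.ofAdd 1 := by
  revert x; decide

/-- `ofAdd 1 ≠ 1` in `Multiplicative (ZMod 2)`. [folklore] -/
theorem ofAdd_one_ne_one : (Multiplicative.ofAdd (1 : ZMod 2)) ≠ 1 := by decide

/-- `ofAdd 1 · ofAdd 1 = 1` in `Multiplicative (ZMod 2)`. [folklore] -/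
theorem ofAdd_one_mul_self : Multiplicative.ofAdd (1 : ZMod 2) * Multiplicative.ofAdd (1 : ZMod 2) = 1 := by decide

/-- Every element of `Multiplicative (ZMod 2)` squares to `1`. [folklore] -/
theorem mul_self_eq_one (x : Multiplicative (ZMod 2)) : x * x = 1 := by
  revert x; decide

/-- In `Multiplicative (ZMod 2)`, `x · y = 1 ↔ x = y`. [folklore] -/
theorem mul_eq_one_iff_eq (x y : Multiplicative (ZMod 2)) : x * y = 1 ↔ x = y := by
  revert x y; decide

/-- In `Multiplicative (ZMod 2)`, `x = y ↔ (x = 1 ↔ y = 1)`. [folklore] -/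
theorem eq_iff_eq_one_iff (x y : Multiplicative (ZMod 2)) : x = y ↔ (x = 1 ↔ y = 1) := by
  revert x y; decide

/-- **The sign character of an index-two subgroup**: `g ↦ 0` on `H`, `1` off `H` (written multiplicatively). [folklore] -/
noncomputable def signChar (H : Subgroup G) (h : H.index = 2) : G →* Multiplicative (ZMod 2) := by
  classical
  exact
    { toFun := fun g => if g ∈ H then 1 else Multiplicative.ofAdd 1
      map_one' := by rw [if_pos H.one_mem]
      map_mul' := fun a b => by
        by_cases ha : a ∈ H <;> by_cases hb : b ∈ H
        · rw [if_pos ((Subgroup.mul_mem_iff_of_index_two h).mpr (iff_of_true ha hb)), if_pos ha, if_pos hb, mul_one]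
        · rw [if_neg (fun hab => hb (((Subgroup.mul_mem_iff_of_index_two h).mp hab).mp ha)), if_pos ha, if_neg hb,
            one_mul]
        · rw [if_neg (fun hab => ha (((Subgroup.mul_mem_iff_of_index_two h).mp hab).mpr hb)), if_neg ha, if_pos hb,
            mul_one]
        · rw [if_pos ((Subgroup.mul_mem_iff_of_index_two h).mpr (iff_of_false ha hb)), if_neg ha, if_neg hb,
            ofAdd_one_mul_self] }

/-- `signChar H g = 1` for `g ∈ H`. [folklore] -/
theorem signChar_apply_of_mem {H : Subgroup G} (h : H.index = 2) {g : G} (hg : g ∈ H) : signChar H h g = 1 := by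
  classical
  unfold signChar
  simp only [MonoidHom.coe_mk, OneHom.coe_mk]
  rw [if_pos hg]

/-- `signChar H g = ofAdd 1` for `g ∉ H`. [folklore] -/
theorem signChar_apply_of_not_mem {H : Subgroup G} (h : H.index = 2) {g : G} (hg : g ∉ H) :
    signChar H h g = Multiplicative.ofAdd 1 := by
  classical
  unfold signChar
  simp only [MonoidHom.coe_mk, OneHom.coe_mk]
  rw [if_neg hg]

/-- **The kernel of the sign character is `H`.** [folklore] -/
theorem ker_signChar {H : Subgroup G} (h : H.index = 2) : (signChar H h).ker = H := by
  ext g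
  rw [MonoidHom.mem_ker]
  by_cases hg : g ∈ H
  · rw [signChar_apply_of_mem h hg]; exact iff_of_true rfl hg
  · rw [signChar_apply_of_not_mem h hg]; exact iff_of_false ofAdd_one_ne_one hg

/-- The sign character is non-trivial. [folklore] -/
theorem signChar_ne_one {H : Subgroup G} (h : H.index = 2) : signChar H h ≠ 1 := by
  intro h1
  have hk : (signChar H h).ker = ⊤ := by rw [h1]; exact MonoidHom.ker_one
  rw [ker_signChar h] at hk
  rw [hk, Subgroup.index_top] at h
  exact absurd h (by decide)

/-- **A non-trivial sign character has a kernel of index two.** [folklore] -/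
theorem index_ker_eq_two (φ : G →* Multiplicative (ZMod 2)) (hφ : φ ≠ 1) : φ.ker.index = 2 := by
  -- `φ` is onto: some `g` has `φ g ≠ 1`, hence `= ofAdd 1`
  have hsurj : Function.Surjective φ := by
    have hex : ∃ g, φ g ≠ 1 := by
      by_contra hcon
      push Not at hcon
      exact hφ (MonoidHom.ext hcon)
    obtain ⟨g, hg⟩ := hex
    have hg' : φ g = Multiplicative.ofAdd 1 := (ne_one_iff_eq_ofAdd_one (φ g)).mp hg
    intro x
    by_cases hx : x = 1
    · exact ⟨1, by rw [hx, map_one]⟩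
    · exact ⟨g, hg'.trans ((ne_one_iff_eq_ofAdd_one x).mp hx).symm⟩
  rw [Subgroup.index_ker, MonoidHom.range_eq_top.2 hsurj, Subgroup.card_top, Nat.card_eq_fintype_card,
    Fintype.card_multiplicative, ZMod.card]

/-- **The sign character of `ker φ` is `φ`.** [folklore] -/
theorem signChar_ker (φ : G →* Multiplicative (ZMod 2)) (hφ : φ ≠ 1) :
    signChar φ.ker (index_ker_eq_two φ hφ) = φ := by
  ext g
  by_cases hg : g ∈ φ.ker
  · rw [signChar_apply_of_mem _ hg]
    exact ((MonoidHom.mem_ker).mp hg).symm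
  · rw [signChar_apply_of_not_mem _ hg]
    exact ((ne_one_iff_eq_ofAdd_one (φ g)).mp (fun h => hg ((MonoidHom.mem_ker).mpr h))).symm

/-- **The kernel of a product of two non-trivial sign characters is the Klein third of their kernels** (for `φ₁ = φ₂` both
sides are `⊤`). [folklore] -/
theorem ker_mul_eq_kleinThird (φ₁ φ₂ : G →* Multiplicative (ZMod 2)) (h₁ : φ₁ ≠ 1) (h₂ : φ₂ ≠ 1) :
    (φ₁ * φ₂).ker = kleinThird φ₁.ker φ₂.ker := by
  ext g
  rw [mem_kleinThird_iff (index_ker_eq_two φ₁ h₁) (index_ker_eq_two φ₂ h₂), MonoidHom.mem_ker, MonoidHom.mem_ker,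
    MonoidHom.mem_ker, MonoidHom.mul_apply, mul_eq_one_iff_eq, eq_iff_eq_one_iff]

/-- **Index-two subgroups ↔ non-trivial sign characters** (`H ↦ signChar H`, `φ ↦ ker φ`). [folklore] -/
noncomputable def indexTwoEquiv :
    {H : Subgroup G // H.index = 2} ≃ {φ : G →* Multiplicative (ZMod 2) // φ ≠ 1} where
  toFun H := ⟨signChar H.1 H.2, signChar_ne_one H.2⟩
  invFun φ := ⟨φ.1.ker, index_ker_eq_two φ.1 φ.2⟩
  left_inv H := Subtype.ext (ker_signChar H.2)
  right_inv φ := Subtype.ext (signChar_ker φ.1 φ.2)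

/-- For a finite type, `#{x ≠ a} + 1 = #α`. [folklore] -/
theorem card_subtype_ne_add_one {α : Type*} [Finite α] (a : α) : Nat.card {x : α // x ≠ a} + 1 = Nat.card α := by
  classical
  letI := Fintype.ofFinite α
  rw [Nat.card_eq_fintype_card, Nat.card_eq_fintype_card, Fintype.card_subtype_compl, Fintype.card_subtype_eq]
  have hpos : 0 < Fintype.card α := Fintype.card_pos_iff.mpr ⟨a⟩
  omega

/-- The sign characters of a finite group form a finite type. [folklore] -/
instance finite_signChar [Finite G] : Finite (G →* Multiplicative (ZMod 2)) :=
  Finite.of_injective (fun φ : G →* Multiplicative (ZMod 2) => (φ : G → Multiplicative (ZMod 2))) DFunLike.coe_injective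

/-- **`#{H : [G:H] = 2} + 1 = #Hom(G, ℤ/2)`** for a finite group. [folklore] -/
theorem card_indexTwo_add_one [Finite G] :
    Nat.card {H : Subgroup G // H.index = 2} + 1 = Nat.card (G →* Multiplicative (ZMod 2)) := by
  rw [Nat.card_congr (indexTwoEquiv (G := G))]
  exact card_subtype_ne_add_one 1

/-! ## §3 Index-two subgroups over a normal subgroup -/

/-- **Index-two subgroups containing a normal `N` ↔ index-two subgroups of `G ⧸ N`** (`H ↦ H/N`, `H' ↦ comap H'`).
[folklore] -/
noncomputable def indexTwoOverEquiv (N : Subgroup G) [N.Normal] :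
    {H : Subgroup G // H.index = 2 ∧ N ≤ H} ≃ {H' : Subgroup (G ⧸ N) // H'.index = 2} where
  toFun H := ⟨H.1.map (QuotientGroup.mk' N), by
    have e : (H.1.map (QuotientGroup.mk' N)).comap (QuotientGroup.mk' N) = H.1 := by
      rw [Subgroup.comap_map_eq, QuotientGroup.ker_mk', sup_eq_left.mpr H.2.2]
    rw [← Subgroup.index_comap_of_surjective _ (QuotientGroup.mk'_surjective N), e]
    exact H.2.1⟩
  invFun H' := ⟨H'.1.comap (QuotientGroup.mk' N), by
    refine ⟨?_, ?_⟩
    · rw [Subgroup.index_comap_of_surjective _ (QuotientGroup.mk'_surjective N)]; exact H'.2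
    · intro x hx
      rw [Subgroup.mem_comap, QuotientGroup.mk'_apply, (QuotientGroup.eq_one_iff x).mpr hx]
      exact H'.1.one_mem⟩
  left_inv H := by
    apply Subtype.ext
    change (H.1.map (QuotientGroup.mk' N)).comap (QuotientGroup.mk' N) = H.1
    rw [Subgroup.comap_map_eq, QuotientGroup.ker_mk', sup_eq_left.mpr H.2.2]
  right_inv H' := by
    apply Subtype.ext
    change (H'.1.comap (QuotientGroup.mk' N)).map (QuotientGroup.mk' N) = H'.1
    rw [Subgroup.map_comap_eq, MonoidHom.range_eq_top.2 (QuotientGroup.mk'_surjective N), top_inf_eq]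

/-- **`#{H : [G:H] = 2, N ≤ H} + 1 = #Hom(G/N, ℤ/2)`** for a finite group and a normal subgroup `N`. [folklore] -/
theorem card_indexTwoOver_add_one [Finite G] (N : Subgroup G) [N.Normal] :
    Nat.card {H : Subgroup G // H.index = 2 ∧ N ≤ H} + 1 = Nat.card (G ⧸ N →* Multiplicative (ZMod 2)) := by
  rw [Nat.card_congr (indexTwoOverEquiv N)]
  exact card_indexTwo_add_one

/-- Fewer index-two subgroups lie over `N` than over any element of `N`: `#{H : N ≤ H} ≤ #{H : g ∈ H}` for `g ∈ N`
(finite `G`; with `g = c` the right side is the `h` of the half-parity bound). [folklore] -/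
theorem card_indexTwoOver_le_of_mem [Finite G] (N : Subgroup G) {g : G} (hg : g ∈ N) :
    Nat.card {H : Subgroup G // H.index = 2 ∧ N ≤ H} ≤ Nat.card {H : Subgroup G // H.index = 2 ∧ g ∈ H} := by
  haveI : Finite {H : Subgroup G // H.index = 2 ∧ g ∈ H} := Subtype.finite
  exact Nat.card_le_card_of_injective (fun H => ⟨H.1, H.2.1, H.2.2 hg⟩)
    (fun H H' h => Subtype.ext (congrArg (fun x => x.1) h))

/-! ## §4 The count is a power of two -/

/-- The sign characters form a `2`-group (every character squares to `1`). [folklore] -/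
theorem isPGroup_signChar : IsPGroup 2 (G →* Multiplicative (ZMod 2)) := by
  intro φ
  refine ⟨1, ?_⟩
  ext g
  rw [pow_one, pow_two, MonoidHom.mul_apply, MonoidHom.one_apply]
  exact mul_self_eq_one (φ g)

/-- **`#Hom(G, ℤ/2) = 2^d`** for a finite group. [folklore] -/
theorem exists_card_signChar_eq_two_pow [Finite G] : ∃ d : ℕ, Nat.card (G →* Multiplicative (ZMod 2)) = 2 ^ d :=
  IsPGroup.iff_card.mp isPGroup_signChar

/-- **`#{H : [G:H] = 2, N ≤ H} + 1 = 2^d`** for a finite group and a normal subgroup `N` — `d = d₂(G/N)`, the `2`-rank of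
`(G/N)^{ab}`. [folklore] -/
theorem exists_card_indexTwoOver_add_one_eq_two_pow [Finite G] (N : Subgroup G) [N.Normal] :
    ∃ d : ℕ, Nat.card {H : Subgroup G // H.index = 2 ∧ N ≤ H} + 1 = 2 ^ d := by
  rw [card_indexTwoOver_add_one N]
  exact exists_card_signChar_eq_two_pow

/-- The special case `N = ⊥`: **`#{H : [G:H] = 2} + 1 = 2^d`**. [folklore] -/
theorem exists_card_indexTwo_add_one_eq_two_pow [Finite G] :
    ∃ d : ℕ, Nat.card {H : Subgroup G // H.index = 2} + 1 = 2 ^ d := by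
  rw [card_indexTwo_add_one]
  exact exists_card_signChar_eq_two_pow

end Generic

end Summit.HodgeConjecture.CorCM.Census.IndexTwo
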